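import Summits.AnomalousDissipation.AnomalousDissipation.Theorems.SolenoidalFractalHomogenisationLagrangianStepSidebandResponseExtFrame
import Summits.AnomalousDissipation.AnomalousDissipation.Theorems.SolenoidalFractalHomogenisationLagrangianStepSidebandXDefsFrame
import HarnessLib

/-!
# K1L_D `LagrangianRenormalisationStepDesign` (stmt-AnomalousDissipation-27980), registered stub `stub_D1_V0thg` (v28, D28-3 (3)/D28-6/D28-7), port-map layer L4:
# the TWISTED reference response is fixed by the twisted class projection (`P^θ ∘ responseθ = responseθ`; transversality of `responseExtθ`)
# (helper; `--kind proof --supports stmt-AnomalousDissipation-27980 --as helper`)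

Summits-side helper file of route `SolenoidalFractalHomogenisation` (prover seat `ad-k1l-cellLawV-w1` g9; road of record D28-7 = port map §3 L4).  Everything proved; no
definitions, no named facts, no sorry.  The frozen-frame twin of `…SidebandResponseTransversal`: `projXθ_one_zero_apply`, `transversalProjR_coordL_projXθ`,
`projXθ_sourceθ`, `projXθ_genθ_comm`, `isPeriodicResponseθ_proj_comp`, **`proj_comp_responseθ_eq`**, `transversalProjR_responseθ_apply`, `transversalProjR_responseExtθ_apply`,
`projXθ_responseExtθ` (uniqueness of the twisted periodic response).  NOT a proof of `stub_D1_V0thg`, of K1L_D, or of anomalous dissipation; rung F-D1.A0 infrastructure.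
-/

set_option linter.dupNamespace false

noncomputable section

namespace Summit.AnomalousDissipation.AnomalousDissipation.Theorems.SolenoidalFractalHomogenisation.LagrangianStep.Sideband

open Set MeasureTheory Complex UnitAddTorus Filter Topology
open scoped InnerProductSpace
open Literature.Analysis Literature.Analysis.FunctionSpaces Literature.Analysis.FunctionSpaces.Torus
open Literature.Analysis.FluidPDE Literature.Analysis.FluidPDE.Torus Literature.Analysis.FluidPDE.LatticeShear
open Summit.AnomalousDissipation.AnomalousDissipation.Theorems.SolenoidalFractalHomogenisation.PermissibleCarrier (period_pos)
open Summit.AnomalousDissipation.AnomalousDissipation.Theorems.SolenoidalFractalHomogenisation.LagrangianStep.CellChain (linkCoeff)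

variable {k₀ : ℕ}

/-! ## §1 The integer-lattice class projection -/

/-- Components of `projXθ 1 0 G₀ R`: `(projXθ 1 0 G₀ R y)_z = P_z y_z`. [cite: Temam1984, Ch. III §1.1] -/
theorem projXθ_one_zero_apply {R : ℕ} (G₀ : Matrix (Fin 3) (Fin 3) ℝ) (y : Space R) (z : box R) : projXθ 1 0 G₀ R y z = transversalProjR (twistFreq G₀ z.1) (y z) := by
  rw [projXθ_apply, classFreq_one_zero]

/-- The projection read through `coordL` and projected again: `P_w (coordL_w (projXθ 1 0 G₀ R y)) = P_w (coordL_w y)`. [cite: Temam1984, Ch. III §1.1] -/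
theorem transversalProjR_coordL_projXθ {R : ℕ} (G₀ : Matrix (Fin 3) (Fin 3) ℝ) (w : Fin 3 → ℤ) (y : Space R) :
    transversalProjR (twistFreq G₀ w) (coordL R w (projXθ 1 0 G₀ R y)) = transversalProjR (twistFreq G₀ w) (coordL R w y) := by
  by_cases hw : w ∈ box R
  · rw [coordL_apply_of_mem hw, coordL_apply_of_mem hw, projXθ_one_zero_apply G₀, transversalProjR_idem]
  · rw [coordL_apply_of_not_mem hw, coordL_apply_of_not_mem hw]

/-- **The class projection fixes the sources** (they are `P_z`-valued). [cite: MajdaKramer1999, §2.2.1.3] -/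
theorem projXθ_sourceθ {R : ℕ} (W₁ : LatticeWord k₀) (G₀ : Matrix (Fin 3) (Fin 3) ℝ) (j : Fin k₀) (t : ℝ) (v : EuclideanSpace ℂ (Fin 3)) :
    projXθ 1 0 G₀ R (sourceθ W₁ G₀ R j t v) = sourceθ W₁ G₀ R j t v := by
  apply PiLp.ext
  intro z
  rw [projXθ_one_zero_apply G₀, sourceθ_apply, sourceCompθ, add_apply]
  by_cases h1 : z.1 = (W₁.phase j).m
  · by_cases h2 : z.1 = -(W₁.phase j).m
    · rw [if_pos h1, if_pos h2, map_add, smul_apply, smul_apply, map_smul, map_smul,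
        transversalProjR_idem]
    · rw [if_pos h1, if_neg h2, zero_apply, add_zero, smul_apply, map_smul, transversalProjR_idem]
  · by_cases h2 : z.1 = -(W₁.phase j).m
    · rw [if_neg h1, if_pos h2, zero_apply, zero_add, smul_apply, map_smul, transversalProjR_idem]
    · rw [if_neg h1, if_neg h2, zero_apply, add_zero, map_zero]

/-- **The class projection commutes with the augmented generator**: `projXθ 1 0 G₀ R (gen t y) = gen t (projXθ 1 0 G₀ R y)`. [cite: MajdaKramer1999, §2.2.1.3] -/
theorem projXθ_genθ_comm {R : ℕ} (W₁ : LatticeWord k₀) (𝔸 : Torus.Visc4 (Fin 3)) (G₀ : Matrix (Fin 3) (Fin 3) ℝ) (γ₁ : ℝ) (t : ℝ) (y : Space R) :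
    projXθ 1 0 G₀ R (genθ W₁ 𝔸 G₀ γ₁ R t y) = genθ W₁ 𝔸 G₀ γ₁ R t (projXθ 1 0 G₀ R y) := by
  apply PiLp.ext
  intro z
  rw [projXθ_one_zero_apply G₀, genθ_apply, genθ_apply, genCompθ_apply, genCompθ_apply]
  simp only [coordL_apply_of_mem z.2, Subtype.coe_eta, projXθ_one_zero_apply G₀, map_sub, map_neg, map_smul, map_sum, map_add,
    transversalProjR_idem, sub_self, smul_zero, sub_zero, transversalProjR_coordL_projXθ]

/-! ## §2 Projecting a periodic response gives a periodic response -/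

/-- **`P ∘ N` is a periodic response if `N` is.** [cite: SandersVerhulstMurdock2007, Lemma 5.2.7 (linear case)] -/
theorem isPeriodicResponseθ_proj_comp {R : ℕ} (W₁ : LatticeWord k₀) (𝔸 : Torus.Visc4 (Fin 3)) (G₀ : Matrix (Fin 3) (Fin 3) ℝ) (γ₁ : ℝ) (j : Fin k₀)
    {N : ℝ → (EuclideanSpace ℂ (Fin 3) →L[ℝ] Space R)} (hN : IsPeriodicResponseθ W₁ 𝔸 G₀ γ₁ R j N) :
    IsPeriodicResponseθ W₁ 𝔸 G₀ γ₁ R j (fun t => ((projXθ 1 0 G₀ R).restrictScalars ℝ).comp (N t)) := by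
  obtain ⟨hc, hd, hp⟩ := hN
  refine ⟨?_, ?_, ?_⟩
  · exact continuousOn_const.clm_comp hc
  · intro t ht
    have h := (hasDerivAt_const t ((projXθ 1 0 G₀ R).restrictScalars ℝ)).clm_comp (hd t ht)
    rw [ContinuousLinearMap.zero_comp, zero_add] at h
    refine h.congr_deriv ?_
    apply ContinuousLinearMap.ext
    intro v
    simp only [ContinuousLinearMap.comp_apply, add_apply, ContinuousLinearMap.coe_restrictScalars', map_add,
      projXθ_sourceθ, projXθ_genθ_comm]
  · simp only [hp]

/-- **THE RESPONSE IS FIXED BY THE CLASS PROJECTION**: `P ∘ response t = response t` on `[0,P]` (uniqueness of the periodic response).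
[cite: SandersVerhulstMurdock2007, Lemma 5.2.7 (linear case)] -/
theorem proj_comp_responseθ_eq {R : ℕ} (W₁ : LatticeWord k₀) {𝔸 : Torus.Visc4 (Fin 3)} {lo' hi' : ℝ} (h𝔸 : Torus.NearIso 𝔸 lo' hi')
    (hlo' : 0 < lo') (G₀ : Matrix (Fin 3) (Fin 3) ℝ) {c : ℝ} (hc : 0 < c) (hG : ∀ k : Fin 3 → ℤ, c * freqNormSq k ≤ ∑ a, twistFreq G₀ k a ^ 2)
    {γ₁ : ℝ} (hγ₁ : 0 < γ₁) (j : Fin k₀) {t : ℝ} (ht : t ∈ Icc 0 W₁.period) :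
    ((projXθ 1 0 G₀ R).restrictScalars ℝ).comp (responseθ W₁ 𝔸 G₀ γ₁ R j t) = responseθ W₁ 𝔸 G₀ γ₁ R j t := by
  have hN := isPeriodicResponseθ_responseθ_of_nearIso W₁ h𝔸 hlo' G₀ hc hG hγ₁ R j
  exact isPeriodicResponseθ_unique W₁ h𝔸 hlo' G₀ hc hG hγ₁ (isPeriodicResponseθ_proj_comp W₁ 𝔸 G₀ γ₁ j hN) hN t ht

/-- **The response is transversal**: `P_z ((response t v) z) = (response t v) z` for `t ∈ [0,P]`. [cite: Temam1984, Ch. III §1.1] -/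
theorem transversalProjR_responseθ_apply {R : ℕ} (W₁ : LatticeWord k₀) {𝔸 : Torus.Visc4 (Fin 3)} {lo' hi' : ℝ} (h𝔸 : Torus.NearIso 𝔸 lo' hi')
    (hlo' : 0 < lo') (G₀ : Matrix (Fin 3) (Fin 3) ℝ) {c : ℝ} (hc : 0 < c) (hG : ∀ k : Fin 3 → ℤ, c * freqNormSq k ≤ ∑ a, twistFreq G₀ k a ^ 2)
    {γ₁ : ℝ} (hγ₁ : 0 < γ₁) (j : Fin k₀) {t : ℝ} (ht : t ∈ Icc 0 W₁.period) (v : EuclideanSpace ℂ (Fin 3)) (z : box R) :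
    transversalProjR (twistFreq G₀ z.1) ((responseθ W₁ 𝔸 G₀ γ₁ R j t v) z) = (responseθ W₁ 𝔸 G₀ γ₁ R j t v) z := by
  have h := congrArg (fun L : EuclideanSpace ℂ (Fin 3) →L[ℝ] Space R => (L v) z) (proj_comp_responseθ_eq W₁ h𝔸 hlo' G₀ hc hG hγ₁ j ht (R := R))
  simp only [ContinuousLinearMap.comp_apply, ContinuousLinearMap.coe_restrictScalars', projXθ_one_zero_apply G₀] at h
  exact h

/-- **The periodic extension is transversal at every time.** [cite: Temam1984, Ch. III §1.1] -/
theorem transversalProjR_responseExtθ_apply {R : ℕ} (W₁ : LatticeWord k₀) {𝔸 : Torus.Visc4 (Fin 3)} {lo' hi' : ℝ} (h𝔸 : Torus.NearIso 𝔸 lo' hi')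
    (hlo' : 0 < lo') (G₀ : Matrix (Fin 3) (Fin 3) ℝ) {c : ℝ} (hc : 0 < c) (hG : ∀ k : Fin 3 → ℤ, c * freqNormSq k ≤ ∑ a, twistFreq G₀ k a ^ 2)
    {γ₁ : ℝ} (hγ₁ : 0 < γ₁) (j : Fin k₀) (t : ℝ) (v : EuclideanSpace ℂ (Fin 3)) (z : box R) :
    transversalProjR (twistFreq G₀ z.1) ((responseExtθ W₁ 𝔸 G₀ γ₁ R j t v) z) = (responseExtθ W₁ 𝔸 G₀ γ₁ R j t v) z := by
  rw [responseExtθ_def]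
  exact transversalProjR_responseθ_apply W₁ h𝔸 hlo' G₀ hc hG hγ₁ j (Ico_subset_Icc_self (by simpa using toIcoMod_mem_Ico' (period_pos W₁) t)) v z

/-- The class-transversal version at `ℓ, n`: `projXθ 1 0 G₀ R (responseExt t v) = responseExt t v`. [cite: Temam1984, Ch. III §1.1] -/
theorem projXθ_responseExtθ {R : ℕ} (W₁ : LatticeWord k₀) {𝔸 : Torus.Visc4 (Fin 3)} {lo' hi' : ℝ} (h𝔸 : Torus.NearIso 𝔸 lo' hi')
    (hlo' : 0 < lo') (G₀ : Matrix (Fin 3) (Fin 3) ℝ) {c : ℝ} (hc : 0 < c) (hG : ∀ k : Fin 3 → ℤ, c * freqNormSq k ≤ ∑ a, twistFreq G₀ k a ^ 2)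
    {γ₁ : ℝ} (hγ₁ : 0 < γ₁) (j : Fin k₀) (t : ℝ) (v : EuclideanSpace ℂ (Fin 3)) :
    projXθ 1 0 G₀ R (responseExtθ W₁ 𝔸 G₀ γ₁ R j t v) = responseExtθ W₁ 𝔸 G₀ γ₁ R j t v := by
  apply PiLp.ext
  intro z
  rw [projXθ_one_zero_apply G₀, transversalProjR_responseExtθ_apply W₁ h𝔸 hlo' G₀ hc hG hγ₁ j t v z]

end Summit.AnomalousDissipation.AnomalousDissipation.Theorems.SolenoidalFractalHomogenisation.LagrangianStep.Sideband

end
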